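import Summits.AnomalousDissipation.AnomalousDissipation.Theorems.MarginalStabilityChainStrainedLayerLawSumRuleLine
import Summits.AnomalousDissipation.AnomalousDissipation.Theorems.MarginalStabilityChainStretchedVortexRowsStubPressureReconstructionTools
import Literature.Analysis.FluidPDE.StretchedLayerStripCalculus

/-!
# Stub `stub_vorticityUniformBounds` (crux stmt-AnomalousDissipation-3007, line `strain-work-sum-rule`) — tools C:
# the pressure drops out of the weak vorticity balance (`∫∫ (∂ₓΦ ∂_yp − ∂_yΦ ∂ₓp) = 0` for `C¹` data)

Support file (`--supports stmt-AnomalousDissipation-3007`; registered sub-goal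
`stub_vorticityUniformBounds_pressureWeak`). Step (a) of the a-priori chain behind the stub is Kato's
`L¹`-antitonicity of the vorticity `ω = ∂ₓv − ∂_yu` of a classical solution of the stretched two-dimensional
Navier–Stokes layer system. Since the velocity is only `C²` and the pressure only `C¹`, the vorticity equation
`∂ₜω + div(ω(u, v − y)) = νΔω` is available in WEAK-IN-SPACE form only, tested against `C¹` functions `Φ(x, y)`
that are `L`-periodic in `x` and vanish for `|y| ≥ R` (tools D); the pressure contributes
`∫∫_{(0,L]×ℝ} (∂ₓΦ ∂_yp − ∂_yΦ ∂ₓp)`, which vanishes — but with `Φ, p ∈ C¹` only, no integration by parts is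
available directly. This file proves the vanishing by FINITE DIFFERENCES in `x`:
for the difference quotient `D_hΦ = (Φ(· + h, ·) − Φ)/h` (still `C¹` in `y`), integration by parts in `y` and
the shift invariance of the period integral give `∫∫ D_hΦ ∂_yp = ∫∫ ∂_yΦ (p − p(· − h, ·))/h` for every `h`, and
dominated convergence `h → 0` on both sides gives `∫∫ ∂ₓΦ ∂_yp = ∫∫ ∂_yΦ ∂ₓp`.

Also here (reused by tools D–F): integrability on the period strip of continuous integrands vanishing for
`|y| ≥ R`, vanishing of the slice derivatives of such test functions outside the support, boundedness of
continuous periodic-times-compact data. All `[folklore]`.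
-/

-- `Summit.<Summit>.<Problem>` is the tree's mandated summit-side namespace (CONVENTIONS §2); for this
-- single-conjunct summit the two coincide, so the duplicate is deliberate.
set_option linter.dupNamespace false

noncomputable section

open scoped Topology ENNReal
open Filter Set Function MeasureTheory

namespace Summit.AnomalousDissipation.AnomalousDissipation.Theorems.StrainedLayerLaw.StrainWorkSumRule

open Literature.Analysis.FluidPDE Literature.Analysis.FluidPDE.StretchedLayer
open Summit.AnomalousDissipation.AnomalousDissipation.Theorems.MarginalStabilityChainStretchedVortexRows

/-! ## Test functions vanishing for `|y| ≥ R`: integrability and support of the derivatives -/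

/-- A continuous function on the plane vanishing on the strip for `|y| ≥ R` is integrable on the period strip
`(0, L] × ℝ` (it is bounded on `[0, L] × [−R, R]`, hence `≤ M e^{R} e^{−|y|}`). [folklore] -/
theorem kato_integrableOn_strip_of_eq_zero {L R : ℝ} {F : ℝ × ℝ → ℝ} (hF : Continuous F)
    (h0 : ∀ x ∈ Ioc 0 L, ∀ y, R ≤ |y| → F (x, y) = 0) : IntegrableOn F (Ioc 0 L ×ˢ univ) := by
  obtain ⟨M, hM⟩ := (isCompact_Icc.prod isCompact_Icc :
    IsCompact (Icc (0:ℝ) L ×ˢ Icc (-R) R)).exists_bound_of_continuousOn hF.continuousOn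
  have hM0 : 0 ≤ max M 0 := le_max_right _ _
  refine integrableOn_strip_of_abs_le_exp hF (C := max M 0 * Real.exp R) (k := 1) (by positivity) one_pos ?_
  intro x hx y
  by_cases hy : R ≤ |y|
  · rw [h0 x hx y hy, abs_zero]; positivity
  · push Not at hy
    have hq : (x, y) ∈ Icc (0:ℝ) L ×ˢ Icc (-R) R := ⟨⟨hx.1.le, hx.2⟩, abs_le.1 hy.le⟩
    have h1 : |F (x, y)| ≤ max M 0 := (Real.norm_eq_abs _ ▸ hM _ hq).trans (le_max_left _ _)
    have h2 : 1 ≤ Real.exp R * Real.exp (-1 * |y|) := by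
      rw [← Real.exp_add]; exact Real.one_le_exp (by linarith)
    calc |F (x, y)| ≤ max M 0 * 1 := by rw [mul_one]; exact h1
      _ ≤ max M 0 * (Real.exp R * Real.exp (-1 * |y|)) := mul_le_mul_of_nonneg_left h2 hM0
      _ = max M 0 * Real.exp R * Real.exp (-1 * |y|) := by ring

/-- `∂ₓΦ = 0` wherever all `x`-slices through `|y| ≥ R` vanish. [folklore] -/
theorem kato_dX_eq_zero {Φ : ℝ → ℝ → ℝ} {R : ℝ} (h0 : ∀ x y, R ≤ |y| → Φ x y = 0) {x y : ℝ}
    (hy : R ≤ |y|) : dX Φ x y = 0 := by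
  have h : (fun s => Φ s y) = fun _ => (0:ℝ) := funext fun s => h0 s y hy
  rw [dX, h, deriv_const]

/-- `∂_yΦ = 0` for `|y| ≥ R + 1` if `Φ` vanishes for `|y| ≥ R` (the slice vanishes near `y`). [folklore] -/
theorem kato_dY_eq_zero {Φ : ℝ → ℝ → ℝ} {R : ℝ} (h0 : ∀ x y, R ≤ |y| → Φ x y = 0) {x y : ℝ}
    (hy : R + 1 ≤ |y|) : dY Φ x y = 0 := by
  have hev : (fun s => Φ x s) =ᶠ[𝓝 y] fun _ => (0:ℝ) := by
    filter_upwards [(isOpen_Ioi.preimage continuous_abs).mem_nhds (show R < |y| by linarith)] with s hs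
    exact h0 x s (le_of_lt hs)
  rw [dY, hev.deriv_eq, deriv_const]

/-- A continuous plane field that is `L`-periodic in `x` (`L > 0`) and vanishes for `|y| ≥ R` is bounded.
[folklore] -/
theorem kato_exists_bound_of_periodic_of_eq_zero {L R : ℝ} (hL : 0 < L) {F : ℝ → ℝ → ℝ}
    (hF : Continuous fun q : ℝ × ℝ => F q.1 q.2) (hper : ∀ x y, F (x + L) y = F x y)
    (h0 : ∀ x y, R ≤ |y| → F x y = 0) : ∃ M : ℝ, 0 ≤ M ∧ ∀ x y, |F x y| ≤ M := by
  obtain ⟨M, hM⟩ := (isCompact_Icc.prod isCompact_Icc :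
    IsCompact (Icc (0:ℝ) L ×ˢ Icc (-R) R)).exists_bound_of_continuousOn hF.continuousOn
  refine ⟨max M 0, le_max_right _ _, fun x y => ?_⟩
  by_cases hy : R ≤ |y|
  · rw [h0 x y hy, abs_zero]; exact le_max_right _ _
  · push Not at hy
    refine abs_le_of_periodic (g := fun s => F s y) hL (fun s => hper s y) (fun s hs => ?_) x
    exact (Real.norm_eq_abs _ ▸ hM (s, y) ⟨hs, abs_le.1 hy.le⟩).trans (le_max_left _ _)

/-- A continuous plane field that is `L`-periodic in `x` (`L > 0`) is bounded on every horizontal band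
`|y| ≤ R`. [folklore] -/
theorem kato_exists_bound_of_periodic {L : ℝ} (hL : 0 < L) {F : ℝ → ℝ → ℝ}
    (hF : Continuous fun q : ℝ × ℝ => F q.1 q.2) (hper : ∀ x y, F (x + L) y = F x y) (R : ℝ) :
    ∃ M : ℝ, 0 ≤ M ∧ ∀ x y, |y| ≤ R → |F x y| ≤ M := by
  obtain ⟨M, hM⟩ := (isCompact_Icc.prod isCompact_Icc :
    IsCompact (Icc (0:ℝ) L ×ˢ Icc (-R) R)).exists_bound_of_continuousOn hF.continuousOn
  refine ⟨max M 0, le_max_right _ _, fun x y hy => ?_⟩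
  refine abs_le_of_periodic (g := fun s => F s y) hL (fun s => hper s y) (fun s hs => ?_) x
  exact (Real.norm_eq_abs _ ▸ hM (s, y) ⟨hs, abs_le.1 hy⟩).trans (le_max_left _ _)

/-! ## The pressure drops out: `∫∫ (∂ₓΦ ∂_yp − ∂_yΦ ∂ₓp) = 0` by finite differences -/

section Pressure

variable {L R : ℝ} {p Φ : ℝ → ℝ → ℝ}

/-- The finite-difference identity: for every `h`,
`∫∫ (Φ(x+h,y) − Φ(x,y))/h · ∂_yp = ∫∫ ∂_yΦ · (p(x,y) − p(x−h,y))/h` on the period strip (integration by parts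
in `y`, then the shift `x ↦ x − h` in the period integral of the periodic `∂_yΦ(· + h) p`). [folklore] -/
theorem kato_pressure_finiteDifference (hL : 0 < L) (hp : ContDiff ℝ 1 (fun q : ℝ × ℝ => p q.1 q.2))
    (hΦ : ContDiff ℝ 1 (fun q : ℝ × ℝ => Φ q.1 q.2)) (hpper : ∀ x y, p (x + L) y = p x y)
    (hΦper : ∀ x y, Φ (x + L) y = Φ x y) (hΦ0 : ∀ x y, R ≤ |y| → Φ x y = 0) (h : ℝ) :
    ∫ q in Ioc 0 L ×ˢ univ, (Φ (q.1 + h) q.2 - Φ q.1 q.2) / h * dY p q.1 q.2 =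
      ∫ q in Ioc 0 L ×ˢ univ, dY Φ q.1 q.2 * ((p q.1 q.2 - p (q.1 - h) q.2) / h) := by
  have hpc : Continuous fun q : ℝ × ℝ => p q.1 q.2 := hp.continuous
  have hΦc : Continuous fun q : ℝ × ℝ => Φ q.1 q.2 := hΦ.continuous
  have hpYc : Continuous fun q : ℝ × ℝ => dY p q.1 q.2 := continuous_dY hp
  have hΦYc : Continuous fun q : ℝ × ℝ => dY Φ q.1 q.2 := continuous_dY hΦ
  have hΦY0 : ∀ x y, R + 1 ≤ |y| → dY Φ x y = 0 := fun x y hy => kato_dY_eq_zero hΦ0 hy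
  -- integration by parts in `y`
  have hibp : ∫ q in Ioc 0 L ×ˢ univ, (Φ (q.1 + h) q.2 - Φ q.1 q.2) / h * dY p q.1 q.2 =
      -∫ q in Ioc 0 L ×ˢ univ, (dY Φ (q.1 + h) q.2 - dY Φ q.1 q.2) / h * p q.1 q.2 := by
    refine integral_strip_mul_dY_eq_neg (f := fun x y => (Φ (x + h) y - Φ x y) / h) (g := p)
      (f' := fun x y => (dY Φ (x + h) y - dY Φ x y) / h) (g' := dY p) ?_ ?_ ?_ ?_ ?_
    · intro x y
      exact ((hasDerivAt_dY_of_contDiff hΦ one_ne_zero (x + h) y).sub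
        (hasDerivAt_dY_of_contDiff hΦ one_ne_zero x y)).div_const h
    · exact fun x y => hasDerivAt_dY_of_contDiff hp one_ne_zero x y
    · refine kato_integrableOn_strip_of_eq_zero (R := R) (by fun_prop) fun x _ y hy => ?_
      simp only [hΦ0 (x + h) y hy, hΦ0 x y hy, sub_zero, zero_div, zero_mul]
    · refine kato_integrableOn_strip_of_eq_zero (R := R + 1) (by fun_prop) fun x _ y hy => ?_
      simp only [hΦY0 (x + h) y hy, hΦY0 x y hy, sub_zero, zero_div, zero_mul]
    · refine kato_integrableOn_strip_of_eq_zero (R := R) (by fun_prop) fun x _ y hy => ?_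
      simp only [hΦ0 (x + h) y hy, hΦ0 x y hy, sub_zero, zero_div, zero_mul]
  rw [hibp]
  -- split and shift
  have hI1 : IntegrableOn (fun q : ℝ × ℝ => dY Φ (q.1 + h) q.2 * p q.1 q.2) (Ioc 0 L ×ˢ univ) :=
    kato_integrableOn_strip_of_eq_zero (R := R + 1) (by fun_prop) fun x _ y hy => by
      simp only [hΦY0 (x + h) y hy, zero_mul]
  have hI2 : IntegrableOn (fun q : ℝ × ℝ => dY Φ q.1 q.2 * p q.1 q.2) (Ioc 0 L ×ˢ univ) :=
    kato_integrableOn_strip_of_eq_zero (R := R + 1) (by fun_prop) fun x _ y hy => by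
      simp only [hΦY0 x y hy, zero_mul]
  have hI3 : IntegrableOn (fun q : ℝ × ℝ => dY Φ q.1 q.2 * p (q.1 - h) q.2) (Ioc 0 L ×ˢ univ) :=
    kato_integrableOn_strip_of_eq_zero (R := R + 1) (by fun_prop) fun x _ y hy => by
      simp only [hΦY0 x y hy, zero_mul]
  have hshift : ∫ q in Ioc 0 L ×ˢ univ, dY Φ (q.1 + h) q.2 * p q.1 q.2 =
      ∫ q in Ioc 0 L ×ˢ univ, dY Φ q.1 q.2 * p (q.1 - h) q.2 := by
    rw [IntegrableOn, volume_restrict_strip] at hI1 hI3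
    rw [volume_restrict_strip, integral_prod_symm _ hI1, integral_prod_symm _ hI3]
    refine integral_congr_ae (Eventually.of_forall fun y => ?_)
    simp only
    have hperF : Function.Periodic (fun x => dY Φ x y * p (x - h) y) L := fun x => by
      simp only
      rw [dY_periodic hΦper, show x + L - h = x - h + L by ring, hpper]
    rw [← intervalIntegral.integral_of_le hL.le, ← intervalIntegral.integral_of_le hL.le]
    have e1 : ∫ x in (0:ℝ)..L, dY Φ (x + h) y * p x y = ∫ x in (0:ℝ)..L, (fun x => dY Φ x y * p (x - h) y) (x + h) := by
      simp only [add_sub_cancel_right]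
    rw [e1, intervalIntegral.integral_comp_add_right (fun x => dY Φ x y * p (x - h) y) h, zero_add,
      show L + h = h + L by ring, hperF.intervalIntegral_add_eq h 0, zero_add]
  have e2 : (fun q : ℝ × ℝ => (dY Φ (q.1 + h) q.2 - dY Φ q.1 q.2) / h * p q.1 q.2) =
      fun q => (1 / h) * (dY Φ (q.1 + h) q.2 * p q.1 q.2 - dY Φ q.1 q.2 * p q.1 q.2) := by
    funext q; ring
  have e3 : (fun q : ℝ × ℝ => dY Φ q.1 q.2 * ((p q.1 q.2 - p (q.1 - h) q.2) / h)) =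
      fun q => (1 / h) * (dY Φ q.1 q.2 * p q.1 q.2 - dY Φ q.1 q.2 * p (q.1 - h) q.2) := by
    funext q; ring
  rw [e2, e3, integral_const_mul, integral_const_mul, integral_sub hI1 hI2, integral_sub hI2 hI3, hshift]
  ring


/-- Mean-value bound for difference quotients: `|deriv g| ≤ M` everywhere ⇒ `|(g(x+h) − g(x))/h| ≤ M`
(also for `h = 0`, where the quotient is `0`). [folklore] -/
theorem kato_abs_slope_le {g : ℝ → ℝ} {M : ℝ} (hg : Differentiable ℝ g) (hM : ∀ s, |deriv g s| ≤ M)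
    (x h : ℝ) : |(g (x + h) - g x) / h| ≤ M := by
  have hM0 : 0 ≤ M := (abs_nonneg _).trans (hM 0)
  rcases eq_or_ne h 0 with rfl | hh
  · rw [div_zero, abs_zero]; exact hM0
  · rw [abs_div, div_le_iff₀ (abs_pos.2 hh)]
    have key := Convex.norm_image_sub_le_of_norm_deriv_le (f := g) (C := M) (s := univ)
      (fun s _ => hg s) (fun s _ => by rw [Real.norm_eq_abs]; exact hM s) convex_univ (mem_univ x)
      (mem_univ (x + h))
    rw [Real.norm_eq_abs, Real.norm_eq_abs, add_sub_cancel_left] at key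
    exact key

/-- **The pressure drops out of the weak vorticity balance** (registered sub-goal
`stub_vorticityUniformBounds_pressureWeak`): for `p, Φ ∈ C¹(ℝ²)`, both `L`-periodic in `x` (`L > 0`), `Φ`
vanishing for `|y| ≥ R`: `∫∫_{(0,L]×ℝ} ∂ₓΦ ∂_yp = ∫∫_{(0,L]×ℝ} ∂_yΦ ∂ₓp` (finite differences in `x`,
`kato_pressure_finiteDifference`, and dominated convergence `h → 0` on both sides). [folklore] -/
theorem stub_vorticityUniformBounds_pressureWeak : ∀ (L R : ℝ) (p Φ : ℝ → ℝ → ℝ), 0 < L →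
    ContDiff ℝ 1 (fun q : ℝ × ℝ => p q.1 q.2) → ContDiff ℝ 1 (fun q : ℝ × ℝ => Φ q.1 q.2) →
    (∀ x y, p (x + L) y = p x y) → (∀ x y, Φ (x + L) y = Φ x y) → (∀ x y, R ≤ |y| → Φ x y = 0) →
      ∫ q in Ioc 0 L ×ˢ univ, dX Φ q.1 q.2 * dY p q.1 q.2 =
        ∫ q in Ioc 0 L ×ˢ univ, dY Φ q.1 q.2 * dX p q.1 q.2 := by
  intro L R p Φ hL hp hΦ hpper hΦper hΦ0
  have hpYc : Continuous fun q : ℝ × ℝ => dY p q.1 q.2 := continuous_dY hp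
  have hpXc : Continuous fun q : ℝ × ℝ => dX p q.1 q.2 := continuous_dX hp
  have hΦYc : Continuous fun q : ℝ × ℝ => dY Φ q.1 q.2 := continuous_dY hΦ
  have hΦXc : Continuous fun q : ℝ × ℝ => dX Φ q.1 q.2 := continuous_dX hΦ
  have hpc : Continuous fun q : ℝ × ℝ => p q.1 q.2 := hp.continuous
  have hΦc : Continuous fun q : ℝ × ℝ => Φ q.1 q.2 := hΦ.continuous
  have hΦX0 : ∀ x y, R ≤ |y| → dX Φ x y = 0 := fun x y hy => kato_dX_eq_zero hΦ0 hy
  have hΦY0 : ∀ x y, R + 1 ≤ |y| → dY Φ x y = 0 := fun x y hy => kato_dY_eq_zero hΦ0 hy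
  -- bounds
  obtain ⟨MΦ, hMΦ0, hMΦ⟩ := kato_exists_bound_of_periodic_of_eq_zero hL hΦXc (dX_periodic hΦper) hΦX0
  obtain ⟨MΦ', hMΦ'0, hMΦ'⟩ :=
    kato_exists_bound_of_periodic_of_eq_zero hL hΦYc (dY_periodic hΦper) hΦY0
  obtain ⟨Mp, hMp0, hMp⟩ := kato_exists_bound_of_periodic hL hpYc (dY_periodic hpper) R
  obtain ⟨Mp', hMp'0, hMp'⟩ := kato_exists_bound_of_periodic hL hpXc (dX_periodic hpper) (R + 1)
  -- the integrable dominating weight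
  have hwc : Continuous fun q : ℝ × ℝ => Real.exp (-1 * |q.2|) :=
    Real.continuous_exp.comp (continuous_const.mul (continuous_abs.comp continuous_snd))
  have hwI : ∀ (K r : ℝ), 0 ≤ K →
      IntegrableOn (fun q : ℝ × ℝ => K * Real.exp r * Real.exp (-1 * |q.2|)) (Ioc 0 L ×ˢ univ) := by
    intro K r hK
    refine integrableOn_strip_of_abs_le_exp (C := K * Real.exp r) (k := 1) (by fun_prop) (by positivity)
      one_pos fun x _ y => ?_
    rw [abs_of_nonneg (by positivity)]
  have hw1 : ∀ (r y : ℝ), |y| < r → 1 ≤ Real.exp r * Real.exp (-1 * |y|) := fun r y hy => by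
    rw [← Real.exp_add]; exact Real.one_le_exp (by linarith)
  have hS : MeasurableSet (Ioc (0:ℝ) L ×ˢ (univ : Set ℝ)) := measurableSet_Ioc.prod MeasurableSet.univ
  -- left-hand side: `∫∫ D_hΦ ∂_yp → ∫∫ ∂ₓΦ ∂_yp`
  have hB : Tendsto (fun h : ℝ => ∫ q in Ioc 0 L ×ˢ univ, (Φ (q.1 + h) q.2 - Φ q.1 q.2) / h * dY p q.1 q.2)
      (𝓝[≠] 0) (𝓝 (∫ q in Ioc 0 L ×ˢ univ, dX Φ q.1 q.2 * dY p q.1 q.2)) := by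
    refine tendsto_integral_filter_of_dominated_convergence
      (fun q : ℝ × ℝ => MΦ * Mp * Real.exp R * Real.exp (-1 * |q.2|)) ?_ ?_ ?_ ?_
    · exact Eventually.of_forall fun h => (Continuous.aestronglyMeasurable (by fun_prop))
    · refine Eventually.of_forall fun h => ae_restrict_of_forall_mem hS ?_
      rintro ⟨x, y⟩ -
      simp only [Real.norm_eq_abs]
      by_cases hy : R ≤ |y|
      · rw [hΦ0 (x + h) y hy, hΦ0 x y hy, sub_zero, zero_div, zero_mul, abs_zero]; positivity
      · push Not at hy
        rw [abs_mul]
        have h1 : |(Φ (x + h) y - Φ x y) / h| ≤ MΦ :=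
          kato_abs_slope_le (g := fun s => Φ s y)
            (fun s => (hasDerivAt_dX_of_contDiff hΦ one_ne_zero s y).differentiableAt)
            (fun s => hMΦ s y) x h
        have h2 : |dY p x y| ≤ Mp := hMp x y hy.le
        calc |(Φ (x + h) y - Φ x y) / h| * |dY p x y| ≤ MΦ * Mp :=
              mul_le_mul h1 h2 (abs_nonneg _) hMΦ0
          _ = MΦ * Mp * 1 := (mul_one _).symm
          _ ≤ MΦ * Mp * (Real.exp R * Real.exp (-1 * |y|)) :=
              mul_le_mul_of_nonneg_left (hw1 R y hy) (by positivity)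
          _ = MΦ * Mp * Real.exp R * Real.exp (-1 * |y|) := by ring
    · exact hwI (MΦ * Mp) R (by positivity)
    · refine Eventually.of_forall fun q => ?_
      have hd := (hasDerivAt_dX_of_contDiff hΦ one_ne_zero q.1 q.2).tendsto_slope_zero
      refine (hd.congr fun h => ?_).mul_const _
      simp only [smul_eq_mul]
      ring
  -- right-hand side: `∫∫ ∂_yΦ (p − p(· − h))/h → ∫∫ ∂_yΦ ∂ₓp`
  have hC : Tendsto (fun h : ℝ => ∫ q in Ioc 0 L ×ˢ univ, dY Φ q.1 q.2 * ((p q.1 q.2 - p (q.1 - h) q.2) / h))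
      (𝓝[≠] 0) (𝓝 (∫ q in Ioc 0 L ×ˢ univ, dY Φ q.1 q.2 * dX p q.1 q.2)) := by
    refine tendsto_integral_filter_of_dominated_convergence
      (fun q : ℝ × ℝ => MΦ' * Mp' * Real.exp (R + 1) * Real.exp (-1 * |q.2|)) ?_ ?_ ?_ ?_
    · exact Eventually.of_forall fun h => (Continuous.aestronglyMeasurable (by fun_prop))
    · refine Eventually.of_forall fun h => ae_restrict_of_forall_mem hS ?_
      rintro ⟨x, y⟩ -
      simp only [Real.norm_eq_abs]
      by_cases hy : R + 1 ≤ |y|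
      · rw [hΦY0 x y hy, zero_mul, abs_zero]; positivity
      · push Not at hy
        rw [abs_mul]
        have h1 : |(p x y - p (x - h) y) / h| ≤ Mp' := by
          have key := kato_abs_slope_le (g := fun s => p s y)
            (fun s => (hasDerivAt_dX_of_contDiff hp one_ne_zero s y).differentiableAt)
            (fun s => hMp' s y hy.le) (x - h) h
          rw [sub_add_cancel] at key; exact key
        have h2 : |dY Φ x y| ≤ MΦ' := hMΦ' x y
        calc |dY Φ x y| * |(p x y - p (x - h) y) / h| ≤ MΦ' * Mp' := mul_le_mul h2 h1 (abs_nonneg _) hMΦ'0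
          _ = MΦ' * Mp' * 1 := (mul_one _).symm
          _ ≤ MΦ' * Mp' * (Real.exp (R + 1) * Real.exp (-1 * |y|)) :=
              mul_le_mul_of_nonneg_left (hw1 (R + 1) y hy) (by positivity)
          _ = MΦ' * Mp' * Real.exp (R + 1) * Real.exp (-1 * |y|) := by ring
    · exact hwI (MΦ' * Mp') (R + 1) (by positivity)
    · -- `h ↦ −h` maps the punctured neighbourhood of `0` to itself (tree: `Elgindi.tendsto_neg_nhdsNE_zero`)
      have hneg : Tendsto (fun h : ℝ => -h) (𝓝[≠] 0) (𝓝[≠] 0) := by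
        refine tendsto_nhdsWithin_of_tendsto_nhds_of_eventually_within _ ?_ ?_
        · have h1 : Tendsto (fun h : ℝ => -h) (𝓝 0) (𝓝 (-0)) := tendsto_neg (0:ℝ)
          rw [neg_zero] at h1
          exact h1.mono_left nhdsWithin_le_nhds
        · filter_upwards [self_mem_nhdsWithin] with h hh
          exact neg_ne_zero.2 hh
      refine Eventually.of_forall fun q => ?_
      have hd := ((hasDerivAt_dX_of_contDiff hp one_ne_zero q.1 q.2).tendsto_slope_zero).comp hneg
      refine (hd.congr fun h => ?_).const_mul _
      simp only [Function.comp_apply, smul_eq_mul]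
      rw [← sub_eq_add_neg]
      field_simp
      ring
  have hEq : (fun h : ℝ => ∫ q in Ioc 0 L ×ˢ univ, (Φ (q.1 + h) q.2 - Φ q.1 q.2) / h * dY p q.1 q.2) =
      fun h => ∫ q in Ioc 0 L ×ˢ univ, dY Φ q.1 q.2 * ((p q.1 q.2 - p (q.1 - h) q.2) / h) :=
    funext fun h => kato_pressure_finiteDifference hL hp hΦ hpper hΦper hΦ0 h
  rw [hEq] at hB
  exact tendsto_nhds_unique hB hC

end Pressure

end Summit.AnomalousDissipation.AnomalousDissipation.Theorems.StrainedLayerLaw.StrainWorkSumRule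

end
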